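import Summits.ResolutionOfSingularities.ResolutionOfSingularities.Theorems.PurelyInseparableDim4JointStep
import Summits.ResolutionOfSingularities.ResolutionOfSingularities.Theorems.PurelyInseparableDim4PointTreeWalk
import HarnessLib

/-!
# Purely inseparable four-folds: the JOINT CHAIN — a COORDINATE blow-up anywhere in the point forest, then the point
# regime, as ONE marked resolution (brick S3 (c) «joint point∘coordinate chains», part 2, cell `res-dim4-pi`)

[OURS · counted 0] (D-0157 DOOR 2; desk WORD #66 (4)(c); frame `PIDim4.TerminationImpliesOrderReduction`, S3 (c);
host item stmt-ResolutionOfSingularities-16155, helper). Nothing here proves resolution of singularities in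
dimension ≥ 4 / characteristic `p` — NOT here, not anywhere in this programme.

Part 1 (`…JointStep`) proved the COVER / HIT / PACKAGE facts for a blowing up along typ-2's global coordinate centre
`Z_c = 𝓘(closure φ(V(z, x_S)))` read by the point regime. Here they are assembled with typ-3's finite-tree induction
(`Equimultiple.exists_isMarkedResolution_of_config_local`, which accepts ANY admissible prefix `IsMultipleBlowup M₀ σ M′`):

* §1 **`finite_closedOver_coord_of_finite_pairs`** — FINITE BRANCHING over a coordinate centre: finitely many
  equimultiple pairs `(j, b)` (`j ∈ S`, `b_j = 0`) at `s` ⇒ only finitely many closed order-`p` points of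
  `M″ = M′.transform π Z_c` over `φ(V(z, x_S))` (two such points with the same pair coincide: the `z`-coordinate is
  THE `p`-th root);
* §2 **`exists_isMarkedResolution_coord_step_then_points`** — THE JOINT CHAIN. Data: an admissible prefix
  `IsMultipleBlowup M₀ σ M′` (`M₀` on a locally Noetherian Jacobson `X`, `HasSNC M₀.boundary`, `mult = p`,
  `K = K̄`); typ-2's INVARIANT(X′, φ, M′, s₁, S) — a full chart `φ : 𝔸⁵_K ⟶ X′` with `M′|_φ = (z^p + s₁.F)·𝒪`, `s₁.F ≠ 0`
  clean, `V(z, x_S)` Hironaka-permissible, `φ(V(z, x_S))` CLOSED in `X′`, and the snc input (FC-1) for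
  `φ^*(M′.boundary)` with `V(z, x_S)`; `π : W → X′` ANY blowing up along `Z_c`; FINITE BRANCHING over the centre with,
  below every equimultiple successor `step p S j b s₁`, a well-founded (`Acc`) and finitely-branching POINT walk; and
  a point CONFIGURATION (typ-3 `…PointTreeLocal` data: zigzag charts, clean `p`-fold states, `Acc`, hereditary one-step
  finiteness) at the OTHER closed order-`p` points of `M′`, all off `φ(V(z, x_S))`. Conclusion:
  `∃ X″ ρ M″, IsMarkedResolution M₀ ρ M″` — the coordinate blow-up `π` is spliced into the point forest as one
  admissible sequence (`ChartDictionary.isMultipleBlowup_extend_coord`), the new configuration on `W` being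
  (survivors, re-charted by zigzag survival off `Z_c`) ⊔ (the finitely many closed order-`p` points over the centre,
  charted by `coord_step_package`), and the point regime finishes.

The ROOT form on `𝔸⁵` (first move a coordinate blow-up of `z^p + F`, hypotheses on polynomials only) is part 3
(`…JointRoot`). HONEST SCOPE: ONE coordinate step (typ-2's monotone chains give more along one branch); positive-
dimensional order-`p` loci AFTER the coordinate step are excluded by the finite-branching hypothesis; FC-1 (snc input)
and the closedness of the chart centre stay hypotheses exactly as in typ-2's `coord_chain_step`. AI-produced
formalisation, weaker than expert review. bears_on: LADDER-RESOLUTION:D157-DOOR2 (res-dim4-pi · S3 (c) joint).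
-/

set_option linter.dupNamespace false -- D-0017: single-problem summit path `Summit.<S>.<S>.…` by design

noncomputable section

open MvPolynomial Finset CategoryTheory AlgebraicGeometry Opposite TopologicalSpace
open AlgebraicGeometry.Scheme.IdealSheafData (ofIdealTop vanishingIdeal)

namespace Summit.ResolutionOfSingularities.ResolutionOfSingularities.Theorems.PIDim4

open Literature.AlgebraicGeometry.Resolution
open Literature.AlgebraicGeometry.Resolution.Hauser2010
open Literature.AlgebraicGeometry.Resolution.AffinePointBlowup (P A γ coord Wtop ξ)

namespace Equimultiple

/-! ## §1 Finite branching over a coordinate centre -/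

section Finite

variable {K : Type} [Field K] {p : ℕ} [hp : Fact p.Prime] [CharP K p] [DecidableEq K]
variable {Z W : Scheme.{0}} (φ : P 4 K ⟶ Z) [IsOpenImmersion φ] {π : W ⟶ Z} {S : Finset (Fin 4)}

omit [DecidableEq K] in
/-- **FINITE BRANCHING ⇒ FINITELY MANY CLOSED ORDER-`p` POINTS OVER THE COORDINATE CENTRE.** In the setting of
`coord_step_cover`: if only finitely many pairs `(j, b)` (`j ∈ S`, `b_j = 0`) are equimultiple points of the coordinate
step at `s`, then `M′` has only finitely many closed points of order `≥ p` over `φ(V(z, x_S))` (two such points with the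
same pair coincide: the `z`-coordinate is THE `p`-th root). [cite: Hauser2010, §F (equiconstant points)] -/
theorem finite_closedOver_coord_of_finite_pairs [IsLocallyNoetherian Z] [IsAlgClosed K] (M : MarkedIdeal Z)
    (hmult : M.mult = p) (s : State K) (hM : M.ideal.comap φ = hypSheaf p s.F)
    (hperm : (p : ℕ∞) ≤ CentreBlowup.ordAlong S s.F)
    (hπ : IsBlowup π (vanishingIdeal (closureImage φ
      ((AffineCoordBlowup.𝓘Λ 4 K (insert 0 (Fin.succ '' (S : Set (Fin 4))))).support : Set (P 4 K)))))
    (hfin : {jb : Fin 4 × (Fin 4 → K) | jb.1 ∈ S ∧ jb.2 jb.1 = 0 ∧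
      CentreBlowup.IsEquimultiplePoint p S jb.1 jb.2 s}.Finite) :
    {w : W | IsClosed ({w} : Set W) ∧
      π w ∈ φ '' (AffineCoordBlowup.CΛ 4 K (insert 0 (Fin.succ '' (S : Set (Fin 4)))) : Set (P 4 K)) ∧
      (p : ℕ∞) ≤ idealOrder (M.transform π (vanishingIdeal (closureImage φ
        ((AffineCoordBlowup.𝓘Λ 4 K (insert 0 (Fin.succ '' (S : Set (Fin 4))))).support : Set (P 4 K))))).ideal w}.Finite := by
  classical
  -- repackage the cover with the pair in front
  have cover : ∀ w : W, IsClosed ({w} : Set W) →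
      π w ∈ φ '' (AffineCoordBlowup.CΛ 4 K (insert 0 (Fin.succ '' (S : Set (Fin 4)))) : Set (P 4 K)) →
      (p : ℕ∞) ≤ idealOrder (M.transform π (vanishingIdeal (closureImage φ
        ((AffineCoordBlowup.𝓘Λ 4 K (insert 0 (Fin.succ '' (S : Set (Fin 4))))).support : Set (P 4 K))))).ideal w →
      ∃ jb : Fin 4 × (Fin 4 → K), ∃ (hj : jb.1 ∈ S) (x : P 4 K) (a : K),
        (π ⁻¹ᵁ φ.opensRange).ι (AffineCoordBlowup.chartImm (ChartDictionary.isBlowup_restrict_globalCentre φ _ hπ)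
            (ChartDictionary.succ_mem_centreVars hj) x) = w ∧
          x.asIdeal = MvPolynomial.vanishingIdeal K {(Fin.cons a jb.2 : Fin (4 + 1) → K)} ∧
            a ^ p + MvPolynomial.eval jb.2 (CentreBlowup.chartTransform p S jb.1 s.F) = 0 ∧ jb.2 jb.1 = 0 ∧
              CentreBlowup.IsEquimultiplePoint p S jb.1 jb.2 s := by
    intro w hw hwx hord
    obtain ⟨j, hj, x, a, b, hxw, hx, hab, hbj, heq⟩ := coord_step_cover φ M hmult s hM hperm hπ hw hwx hord
    exact ⟨(j, b), hj, x, a, hxw, hx, hab, hbj, heq⟩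
  let g : W → Fin 4 × (Fin 4 → K) := fun w =>
    if hc : IsClosed ({w} : Set W) ∧
        π w ∈ φ '' (AffineCoordBlowup.CΛ 4 K (insert 0 (Fin.succ '' (S : Set (Fin 4)))) : Set (P 4 K)) ∧
        (p : ℕ∞) ≤ idealOrder (M.transform π (vanishingIdeal (closureImage φ
          ((AffineCoordBlowup.𝓘Λ 4 K (insert 0 (Fin.succ '' (S : Set (Fin 4))))).support : Set (P 4 K))))).ideal w
    then (cover w hc.1 hc.2.1 hc.2.2).choose else ((0 : Fin 4), (0 : Fin 4 → K))
  refine Set.Finite.of_finite_image (f := g) (hfin.subset ?_) ?_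
  · rintro _ ⟨w, hw, rfl⟩
    have hg : g w = (cover w hw.1 hw.2.1 hw.2.2).choose := dif_pos hw
    obtain ⟨hj, x, a, -, -, -, hbj, heq⟩ := (cover w hw.1 hw.2.1 hw.2.2).choose_spec
    rw [hg]
    exact ⟨hj, hbj, heq⟩
  · intro w hw w' hw' hgg
    have hg : g w = (cover w hw.1 hw.2.1 hw.2.2).choose := dif_pos hw
    have hg' : g w' = (cover w' hw'.1 hw'.2.1 hw'.2.2).choose := dif_pos hw'
    -- two points with the same pair coincide
    have key : ∀ jb jb' : Fin 4 × (Fin 4 → K), jb = jb' →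
        (∃ (hj : jb.1 ∈ S) (x : P 4 K) (a : K),
          (π ⁻¹ᵁ φ.opensRange).ι (AffineCoordBlowup.chartImm (ChartDictionary.isBlowup_restrict_globalCentre φ _ hπ)
              (ChartDictionary.succ_mem_centreVars hj) x) = w ∧
            x.asIdeal = MvPolynomial.vanishingIdeal K {(Fin.cons a jb.2 : Fin (4 + 1) → K)} ∧
              a ^ p + MvPolynomial.eval jb.2 (CentreBlowup.chartTransform p S jb.1 s.F) = 0 ∧ jb.2 jb.1 = 0 ∧
                CentreBlowup.IsEquimultiplePoint p S jb.1 jb.2 s) →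
        (∃ (hj : jb'.1 ∈ S) (x : P 4 K) (a : K),
          (π ⁻¹ᵁ φ.opensRange).ι (AffineCoordBlowup.chartImm (ChartDictionary.isBlowup_restrict_globalCentre φ _ hπ)
              (ChartDictionary.succ_mem_centreVars hj) x) = w' ∧
            x.asIdeal = MvPolynomial.vanishingIdeal K {(Fin.cons a jb'.2 : Fin (4 + 1) → K)} ∧
              a ^ p + MvPolynomial.eval jb'.2 (CentreBlowup.chartTransform p S jb'.1 s.F) = 0 ∧ jb'.2 jb'.1 = 0 ∧
                CentreBlowup.IsEquimultiplePoint p S jb'.1 jb'.2 s) →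
        w = w' := by
      rintro jb _ rfl ⟨hj, x, a, hxw, hx, hab, -, -⟩ ⟨hj', x', a', hxw', hx', hab', -, -⟩
      have haa : a = a' := by
        apply frobenius_inj K p
        rw [frobenius_def, frobenius_def, eq_neg_of_add_eq_zero_left hab, eq_neg_of_add_eq_zero_left hab']
      have hxx : x = x' := by
        apply PrimeSpectrum.ext
        rw [hx, hx', haa]
      rw [← hxw, ← hxw', hxx]
    exact key _ _ (hg.symm.trans (hgg.trans hg')) (cover w hw.1 hw.2.1 hw.2.2).choose_spec
      (cover w' hw'.1 hw'.2.1 hw'.2.2).choose_spec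

end Finite

/-! ## §2 The joint chain: a coordinate blow-up spliced into the point forest -/

section JointChain

variable {K : Type} [Field K] {p : ℕ} [hp : Fact p.Prime] [CharP K p]

/-- **THE JOINT CHAIN (coordinate step anywhere in the point forest, then points).** See the module docstring for the
data. Conclusion: the marked ideal `M₀` admits a marked resolution (BGMW Def. 3.1.3) obtained by continuing the prefix
`σ` with the blowing up `π` of the GLOBAL coordinate centre `𝓘(closure φ(V(z, x_S)))` and then with point blow-ups
only. [cite: BierstoneGrigorievMilmanWlodarczyk2011, Def. 3.1.3] [cite: Hauser2010, §§F–G]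
[cite: Hironaka1964, Main Theorem I (the characteristic-zero statement whose analogue is asked)] -/
theorem exists_isMarkedResolution_coord_step_then_points {X : Scheme.{0}} [IsLocallyNoetherian X] [JacobsonSpace X]
    [IsAlgClosed K] [DecidableEq K] (M₀ : MarkedIdeal X) (hE : HasSNC M₀.boundary) (hmult : M₀.mult = p)
    {X' W : Scheme.{0}} {σ : X' ⟶ X} {M' : MarkedIdeal X'} (hσ : IsMultipleBlowup M₀ σ M')
    (φ : P 4 K ⟶ X') [IsOpenImmersion φ] (s₁ : State K) (hM₁ : M'.ideal.comap φ = hypSheaf p s₁.F)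
    (hF₁ : s₁.F ≠ 0) (hclean₁ : Literature.Barriers.ResolutionOfSingularities.HauserPerlega.IsClean p s₁.F)
    {S : Finset (Fin 4)} (hS : IsPermissibleCentre p S s₁.F)
    (hT : IsClosed (φ '' (AffineCoordBlowup.CΛ 4 K (insert 0 (Fin.succ '' (S : Set (Fin 4)))) : Set (P 4 K))))
    (hEc : HasSNCWith (M'.boundary.map (·.comap φ))
      (AffineCoordBlowup.𝓘Λ 4 K (insert 0 (Fin.succ '' (S : Set (Fin 4))))))
    {π : W ⟶ X'} (hπ : IsBlowup π (vanishingIdeal (closureImage φ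
      ((AffineCoordBlowup.𝓘Λ 4 K (insert 0 (Fin.succ '' (S : Set (Fin 4))))).support : Set (P 4 K)))))
    (hfin : {jb : Fin 4 × (Fin 4 → K) | jb.1 ∈ S ∧ jb.2 jb.1 = 0 ∧
      CentreBlowup.IsEquimultiplePoint p S jb.1 jb.2 s₁}.Finite)
    (hwalk : ∀ (j : Fin 4) (b : Fin 4 → K), j ∈ S → b j = 0 → CentreBlowup.IsEquimultiplePoint p S j b s₁ →
      Acc (fun s' s : State K => Edge p Finset.univ s s') (CentreBlowup.step p S j b s₁) ∧
        ∀ s' : State K, Relation.ReflTransGen (fun a c : State K => Edge p Finset.univ a c)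
            (CentreBlowup.step p S j b s₁) s' →
          {jb : Fin 4 × (Fin 4 → K) | jb.2 jb.1 = 0 ∧
            CentreBlowup.IsEquimultiplePoint p Finset.univ jb.1 jb.2 s'}.Finite)
    (pts : Finset X') (st : X' → State K) (hclosed : ∀ x ∈ pts, IsClosed ({x} : Set X'))
    (hoff : ∀ x ∈ pts, x ∉ φ '' (AffineCoordBlowup.CΛ 4 K (insert 0 (Fin.succ '' (S : Set (Fin 4)))) : Set (P 4 K)))
    (hcover : ∀ z : X', IsClosed ({z} : Set X') → (p : ℕ∞) ≤ idealOrder M'.ideal z →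
      z ∈ φ '' (AffineCoordBlowup.CΛ 4 K (insert 0 (Fin.succ '' (S : Set (Fin 4)))) : Set (P 4 K)) ∨ z ∈ pts)
    (hdata : ∀ x ∈ pts, (st x).F ≠ 0 ∧
      Literature.Barriers.ResolutionOfSingularities.HauserPerlega.IsClean p (st x).F ∧
      (p : ℕ∞) ≤ CentreBlowup.ordAlong (Finset.univ : Finset (Fin 4)) (st x).F ∧
      Acc (fun s' s : State K => Edge p Finset.univ s s') (st x) ∧
      (∀ s' : State K, Relation.ReflTransGen (fun a b : State K => Edge p Finset.univ a b) (st x) s' →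
        {w' : blowup (Scheme.IdealSheafData.vanishingIdeal (AffinePointBlowup.C₀ 4 K)) |
          IsClosed ({w'} : Set (blowup (Scheme.IdealSheafData.vanishingIdeal (AffinePointBlowup.C₀ 4 K)))) ∧
          blowup.π (Scheme.IdealSheafData.vanishingIdeal (AffinePointBlowup.C₀ 4 K)) w' = ξ 4 K ∧
          (p : ℕ∞) ≤ idealOrder ((⟨hypSheaf p s'.F, [], p⟩ : MarkedIdeal (P 4 K)).transform
            (blowup.π (Scheme.IdealSheafData.vanishingIdeal (AffinePointBlowup.C₀ 4 K)))
            (Scheme.IdealSheafData.vanishingIdeal (AffinePointBlowup.C₀ 4 K))).ideal w'}.Finite) ∧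
      ∃ (Y : Scheme.{0}) (φx : Y ⟶ X') (ψ : Y ⟶ P 4 K) (_ : IsOpenImmersion φx) (_ : IsOpenImmersion ψ) (y : Y),
        φx y = x ∧ ψ y = ξ 4 K ∧ M'.ideal.comap φx = (hypSheaf p (st x).F).comap ψ) :
    ∃ (X'' : Scheme.{0}) (ρ : X'' ⟶ X) (M'' : MarkedIdeal X''), IsMarkedResolution M₀ ρ M'' := by
  classical
  haveI : IsLocallyNoetherian X' := hσ.isLocallyNoetherian
  have hmult' : M'.mult = p := hσ.mult_eq.trans hmult
  have hE' : HasSNC M'.boundary := hσ.hasSNC_boundary hE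
  set C : X'.IdealSheafData := vanishingIdeal (closureImage φ
      ((AffineCoordBlowup.𝓘Λ 4 K (insert 0 (Fin.succ '' (S : Set (Fin 4))))).support : Set (P 4 K))) with hC
  -- the coordinate blow-up is admissible (typ-2)
  have h₁ : IsMultipleBlowup M₀ (π ≫ σ) (M'.transform π C) :=
    ChartDictionary.isMultipleBlowup_extend_coord φ hσ hmult' hM₁ hS.2 hT hE' hEc hπ
  haveI : IsLocallyNoetherian W := h₁.isLocallyNoetherian
  set M'' := M'.transform π C with hM''
  have hM''I : M''.ideal = controlledTransform π C M'.ideal M'.mult := rfl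
  have hsuppC : ∀ z : X', z ∉ (C.support : Set X') ↔
      z ∉ φ '' (AffineCoordBlowup.CΛ 4 K (insert 0 (Fin.succ '' (S : Set (Fin 4)))) : Set (P 4 K)) := fun z => by
    rw [hC, ChartDictionary.coe_support_globalCentre φ hT]
  -- the package at the closed order-`p` points over the centre (part 1), pair in front
  have pkg : ∀ w : W, IsClosed ({w} : Set W) →
      π w ∈ φ '' (AffineCoordBlowup.CΛ 4 K (insert 0 (Fin.succ '' (S : Set (Fin 4)))) : Set (P 4 K)) →
      (p : ℕ∞) ≤ idealOrder M''.ideal w →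
      ∃ jb : Fin 4 × (Fin 4 → K), jb.1 ∈ S ∧ jb.2 jb.1 = 0 ∧
        Edge p S s₁ (CentreBlowup.step p S jb.1 jb.2 s₁) ∧ CentreBlowup.IsEquimultiplePoint p S jb.1 jb.2 s₁ ∧
        ∃ (Y' : Scheme.{0}) (φ' : Y' ⟶ W) (ψ' : Y' ⟶ P 4 K) (_ : IsOpenImmersion φ') (_ : IsOpenImmersion ψ')
          (y' : Y'), φ' y' = w ∧ ψ' y' = ξ 4 K ∧
          M''.ideal.comap φ' = (hypSheaf p (CentreBlowup.step p S jb.1 jb.2 s₁).F).comap ψ' := by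
    intro w hw hwx hord
    obtain ⟨j, hj, b, hbj, hedge, heq, Θ, h, -, -, hξw, hc, -⟩ :=
      coord_step_package φ M' hmult' s₁ hM₁ hF₁ hclean₁ hS hπ hw hwx hord
    haveI := isOpenImmersion_specMap_algEquiv Θ
    haveI : IsProper π := hπ.isProper
    exact ⟨(j, b), hj, hbj, hedge, heq, P 4 K, _, 𝟙 _, inferInstance, inferInstance, ξ 4 K, hξw, rfl,
      by rw [Scheme.IdealSheafData.comap_id]; exact hc⟩
  -- the points over the centre: finitely many
  have hoverfin := finite_closedOver_coord_of_finite_pairs φ M' hmult' s₁ hM₁ hS.2 hπ hfin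
  set ov : Finset W := hoverfin.toFinset with hov_def
  have hmem_over : ∀ w : W, w ∈ ov ↔ IsClosed ({w} : Set W) ∧
      π w ∈ φ '' (AffineCoordBlowup.CΛ 4 K (insert 0 (Fin.succ '' (S : Set (Fin 4)))) : Set (P 4 K)) ∧
      (p : ℕ∞) ≤ idealOrder M''.ideal w := fun w => by
    rw [hov_def, Set.Finite.mem_toFinset, Set.mem_setOf_eq]
  -- the survivors: the unique preimages of the configuration points (all off the centre)
  have hpre : ∀ z : {z // z ∈ pts}, ∃ w : W, π w = z.1 := fun z =>
    exists_eq_of_not_mem_support hπ ((hsuppC z.1).mpr (hoff z.1 z.2))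
  set pre : {z // z ∈ pts} → W := fun z => (hpre z).choose with hpre_def
  have hπpre : ∀ z : {z // z ∈ pts}, π (pre z) = z.1 := fun z => (hpre z).choose_spec
  have hpre_inj : Function.Injective pre := by
    intro z z' hzz
    apply Subtype.ext
    rw [← hπpre z, ← hπpre z', hzz]
  set surv : Finset W := pts.attach.image pre with hsurv_def
  have hmem_surv : ∀ w : W, w ∈ surv ↔ π w ∈ pts := by
    intro w
    rw [hsurv_def, Finset.mem_image]
    constructor
    · rintro ⟨z, -, rfl⟩
      rw [hπpre z]
      exact z.2
    · intro hw
      refine ⟨⟨π w, hw⟩, Finset.mem_attach _ _, ?_⟩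
      exact eq_of_eq_of_not_mem_support hπ (hπpre _) (by rw [hπpre]; exact (hsuppC _).mpr (hoff _ hw))
  have hdisj : Disjoint ov surv := by
    rw [Finset.disjoint_left]
    intro w hw hw'
    exact hoff _ ((hmem_surv w).mp hw') ((hmem_over w).mp hw).2.1
  set pts' : Finset W := ov.disjUnion surv hdisj with hpts'
  have hmem' : ∀ w : W, w ∈ pts' ↔ w ∈ ov ∨ w ∈ surv := fun w => Finset.mem_disjUnion
  -- orders and closedness of the survivors
  have hsurv_ord : ∀ w : W,
      π w ∉ φ '' (AffineCoordBlowup.CΛ 4 K (insert 0 (Fin.succ '' (S : Set (Fin 4)))) : Set (P 4 K)) →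
      idealOrder M''.ideal w = idealOrder M'.ideal (π w) := fun w hwx => by
    rw [hM''I]
    exact idealOrder_controlledTransform_eq_of_eq_of_not_mem_support hπ ((hsuppC _).mpr hwx) M'.ideal M'.mult rfl
  have hsurv_closed : ∀ w ∈ surv, IsClosed ({w} : Set W) := by
    intro w hw
    have hz := (hmem_surv w).mp hw
    exact isClosed_singleton_of_not_mem_support hπ (hclosed _ hz) ((hsuppC _).mpr (hoff _ hz))
  -- the new states: coordinate-step successors over the centre, the old states elsewhere
  set st' : W → State K := fun w =>
    if hc : IsClosed ({w} : Set W) ∧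
        π w ∈ φ '' (AffineCoordBlowup.CΛ 4 K (insert 0 (Fin.succ '' (S : Set (Fin 4)))) : Set (P 4 K)) ∧
        (p : ℕ∞) ≤ idealOrder M''.ideal w then
      CentreBlowup.step p S (pkg w hc.1 hc.2.1 hc.2.2).choose.1 (pkg w hc.1 hc.2.1 hc.2.2).choose.2 s₁
    else st (π w) with hst'
  have hover : ∀ w ∈ ov, ∃ (j : Fin 4) (b : Fin 4 → K), st' w = CentreBlowup.step p S j b s₁ ∧ j ∈ S ∧ b j = 0 ∧
      Edge p S s₁ (CentreBlowup.step p S j b s₁) ∧ CentreBlowup.IsEquimultiplePoint p S j b s₁ ∧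
      ∃ (Y' : Scheme.{0}) (φ' : Y' ⟶ W) (ψ' : Y' ⟶ P 4 K) (_ : IsOpenImmersion φ') (_ : IsOpenImmersion ψ')
        (y' : Y'), φ' y' = w ∧ ψ' y' = ξ 4 K ∧
        M''.ideal.comap φ' = (hypSheaf p (CentreBlowup.step p S j b s₁).F).comap ψ' := by
    intro w hw
    have hc := (hmem_over w).mp hw
    refine ⟨(pkg w hc.1 hc.2.1 hc.2.2).choose.1, (pkg w hc.1 hc.2.1 hc.2.2).choose.2, ?_,
      (pkg w hc.1 hc.2.1 hc.2.2).choose_spec⟩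
    rw [hst']
    exact dif_pos hc
  have hoff' : ∀ w : W,
      π w ∉ φ '' (AffineCoordBlowup.CΛ 4 K (insert 0 (Fin.succ '' (S : Set (Fin 4)))) : Set (P 4 K)) →
      st' w = st (π w) := by
    intro w hwx
    rw [hst']
    exact dif_neg fun hc => hwx hc.2.1
  -- the multiset of new states is accessible
  haveI : Std.Irrefl (fun s' s : State K => Edge p Finset.univ s s' ∧ s' ≠ s) := ⟨fun s hs => hs.2 rfl⟩
  have hT : Acc (Relation.CutExpand (fun s' s : State K => Edge p Finset.univ s s' ∧ s' ≠ s))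
      (pts'.val.map st') := by
    refine Relation.acc_of_singleton fun s hs => ?_
    rw [Multiset.mem_map] at hs
    obtain ⟨w, hw, rfl⟩ := hs
    have hacc : Acc (fun s' s : State K => Edge p Finset.univ s s') (st' w) := by
      rcases (hmem' w).mp (Finset.mem_val.mp hw) with hw | hw
      · obtain ⟨j, b, hst'w, hj, hbj, -, heq, -⟩ := hover w hw
        rw [hst'w]
        exact (hwalk j b hj hbj heq).1
      · have hz := (hmem_surv w).mp hw
        rw [hoff' w (hoff _ hz)]
        exact (hdata _ hz).2.2.2.1
    exact (Subrelation.accessible (fun hs => hs.1) hacc).cutExpand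
  -- hand the new stage to the point regime
  refine exists_isMarkedResolution_of_config_local M₀ hE hmult _ hT W (π ≫ σ) M'' h₁ pts' st' rfl
    (fun w hw => ?_) (fun z hz hzo => ?_) fun w hw => ?_
  · rcases (hmem' w).mp hw with hw | hw
    · exact ((hmem_over w).mp hw).1
    · exact hsurv_closed w hw
  · rw [hmem']
    by_cases hzx : π z ∈ φ '' (AffineCoordBlowup.CΛ 4 K (insert 0 (Fin.succ '' (S : Set (Fin 4)))) : Set (P 4 K))
    · exact Or.inl ((hmem_over z).mpr ⟨hz, hzx, hzo⟩)
    · refine Or.inr ((hmem_surv z).mpr ?_)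
      rcases hcover _ (isClosed_singleton_π' hπ hz) (by rw [← hsurv_ord z hzx]; exact hzo) with h | h
      · exact absurd h hzx
      · exact h
  · rcases (hmem' w).mp hw with hw | hw
    · obtain ⟨j, b, hst'w, hj, hbj, hedge, heq, Y', φ', ψ', _, _, y', hφ', hψ', hM'⟩ := hover w hw
      obtain ⟨j'', b'', -, -, heq'', hF'', hs''⟩ := id hedge
      rw [hst'w]
      refine ⟨by rw [hs'']; exact hF'', isClean_step S j b s₁,
        by rw [hs'']; exact ordAlong_univ_step_of_isEquimultiplePoint' S j'' b'' s₁ heq'', (hwalk j b hj hbj heq).1,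
        fun s' hs' => ?_, Y', φ', ψ', inferInstance, inferInstance, y', hφ', hψ', hM'⟩
      exact finite_closedOver_model_of_finite_pairs s'
        (ordAlong_univ_of_reflTransGen_edge (ordAlong_univ_step_of_isEquimultiplePoint' S j b s₁ heq) hs')
        ((hwalk j b hj hbj heq).2 s' hs')
    · have hz := (hmem_surv w).mp hw
      obtain ⟨hFz, hcleanz, hpermz, haccz, hlocfinz, Yz, φz, ψz, _, _, yz, hφz, hψz, hMz⟩ := hdata _ hz
      have hnot : π w ∉ (C.support : Set X') := (hsuppC _).mpr (hoff _ hz)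
      obtain ⟨Y', φ', ψ', _, _, y', hφ', hψ', hM'⟩ :=
        exists_zigzag_comap_controlledTransform_of_not_mem_support hπ hnot φz ψz yz hφz hψz M'.ideal
          (hypSheaf p (st (π w)).F) hMz M'.mult (w := w) rfl
      rw [hoff' w (hoff _ hz)]
      exact ⟨hFz, hcleanz, hpermz, haccz, hlocfinz, Y', φ', ψ', inferInstance, inferInstance, y', hφ', hψ',
        by rw [hM''I]; exact hM'⟩

end JointChain

end Equimultiple

end Summit.ResolutionOfSingularities.ResolutionOfSingularities.Theorems.PIDim4

end
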